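import Summits.BirchSwinnertonDyer.BirchSwinnertonDyer.Theorems.ClassRecordThreeEulerHalvesAtThreeCartanSatOfNoFixed
import HarnessLib

/-!
# Crux 23422 `EulerHalvesAtThreeResidualUpperBound` ∕ 19109, line `cartan` v14: the CONSTRUCTOR CONTRACT of the geometric node (F2b♮) —
# a saturated pre-datum from NOTHING BUT a Cartan torus lattice, two torus-fixed vectors not divisible by `3`, and the two sheet counts

Seat `bsd-stepL-tam3-p1` g25 (prover, LINE OWNER of stmt-BirchSwinnertonDyer-23422 ∕ 19109; `--supports stmt-BirchSwinnertonDyer-23422 --as helper`).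
Companion of `…CartanSatOfNoFixed` (p722297: (SAT₃) ⟸ `(𝓛∕3𝓛)^G = 0`; (F2b♮) ⟺ (F2b♭) ⟺ NUM). PURPOSE: strip the open node (F2b♮)
`CartanSaturatedDictionary.CartanHomLatticeSaturatedDictionaryAtThree` of everything that is NOT geometry, so that a future constructor (the Hom-lattice
`𝕃 = Hom(J_X̄, E₀)` with its degree form, NUM-PROOF-SKETCH rev 3 ∕ NUM-VETTING) owes exactly:
  (i)   a `CartanDegree.CartanTorusLattice q` — `𝕃 ≅ ℤ^d` with its `GL₂(𝔽_q)`-action, `tr = cubicNewvectorChar q` (multiplicity one), the degree form `B`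
        (positive, invariant), `(𝕃∕3𝕃)^G = 0` (the one Ihara-type input; at cusp primes automatic, p710975), any elliptic `η`;
  (ii)  two vectors `u_S ∈ 𝕃^{T_s}`, `u_C ∈ 𝕃^{C(η)}` (pull-backs of the optimal parametrisations of the torus quotients) NOT DIVISIBLE BY `3` in `𝕃`
        (the descent lemma, NUM-VETTING A1) — no generators, no indices;
  (iii) `c > 0` and the two SHEET COUNTS `c·B(u_S,u_S) = ½(q−1)²·degX0`, `c·B(u_C,u_C) = ½(q²−1)·degC` with `degX0`, `degC` the class-minimal degrees.
Everything else in `CartanTorusDegreeDataPre` — generators `w_S`, `w_C` of the torus lines, the indices `idx_T` with `3 ∤ idx_T`, and (SAT₃) — is SUPPLIED HERE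
by finite-group theory: the torus lines of ANY Cartan torus lattice are lines with generators (`exists_splitLine_gen`, `exists_nonsplitLine_gen`: rank by
trace, `CartanSupply.CubicLattice.exists_generator_of_trace_rep` + the tree's torus sums `Σ_T χ_W = |T|`; `q = 2` by rank one), `3 ∤ idx` ⟺ `u ∉ 3𝕃` on a line,
and (SAT₃) by `CartanSatOfNoFixed.satThree_ofDegreeData`.
RESULTS: `exists_degreeData_of_lattice` (a full torus–degree datum), `exists_saturatedPre_of_lattice` (a saturated pre-datum, same degrees),
`saturatedDictionary_of_latticeDictionary` (the THIN form of the dictionary — binders of (F2b♮), conclusion «∃ lattice + two vectors + sheet counts realising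
the class-minimal degrees 3-adically» — implies (F2b♮); stated with the thin form INLINE, no new definition).
HONEST FRAMING: finite-group bookkeeping only; (F2b♮) ∕ NUM ∕ 23422 ∕ 19109 are NOT proved; no route item, no registered stub, no summit statement is proved;
BSD is proved for no curve. [folklore]
-/

set_option linter.dupNamespace false
set_option autoImplicit false

namespace Summit.BirchSwinnertonDyer.BirchSwinnertonDyer.Theorems.CartanPreDatumOfLattice

open Summit.BirchSwinnertonDyer.BirchSwinnertonDyer.Theorems.CartanDegree
open Summit.BirchSwinnertonDyer.BirchSwinnertonDyer.Theorems.CartanTorusCubeCut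
open Summit.BirchSwinnertonDyer.BirchSwinnertonDyer.Theorems.CartanSupply
open Summit.BirchSwinnertonDyer.BirchSwinnertonDyer.Theorems.CartanSupply.CubicLattice
open Summit.BirchSwinnertonDyer.BirchSwinnertonDyer.Theorems.CartanSaturatedDictionary
open Summit.BirchSwinnertonDyer.BirchSwinnertonDyer.Theorems.CartanSatOfNoFixed
open WeierstrassCurve Literature.NumberTheory.Automorphic Literature.NumberTheory.EllipticCurves.Rank1Residual
  Summit.BirchSwinnertonDyer.Rank1Residual
open scoped Classical

/-! ## §1 The two torus lines of ANY Cartan torus lattice have generators -/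

section lines

variable {q : ℕ} [Fact q.Prime]

/-- PROVED — **THE SPLIT-TORUS LINE** of any Cartan torus lattice (every prime `q`): a non-zero `T_s`-fixed `w_S` of which every `T_s`-fixed vector is a multiple
(rank by trace: `Σ_{T_s} χ_W = |T_s|`, `CartanSupply.sum_char_splitTorusSub`). [folklore] -/
theorem exists_splitLine_gen (𝓛 : CartanTorusLattice q) :
    ∃ w : Fin 𝓛.d → ℤ, 𝓛.IsSplitFixed w ∧ w ≠ 0 ∧ ∀ v : Fin 𝓛.d → ℤ, 𝓛.IsSplitFixed v → ∃ m : ℤ, v = m • w := by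
  have hsum : ∑ t : splitTorusSub q, LinearMap.trace ℤ (Fin 𝓛.d → ℤ) (𝓛.ρ (t : G q)) = Nat.card (splitTorusSub q) := by
    simp_rw [𝓛.trace_eq]
    exact sum_char_splitTorusSub
  obtain ⟨w, hw, hw0, hgen⟩ :=
    exists_generator_of_trace_rep (𝓛.ρ : G q →* Module.End ℤ (Fin 𝓛.d → ℤ)) (splitTorusSub q) hsum
  refine ⟨w, fun g h01 h10 => hw g ((mem_splitTorusSub_iff g).mpr ⟨h01, h10⟩), hw0, fun v hv => hgen v fun t ht => ?_⟩
  exact hv t ((mem_splitTorusSub_iff t).mp ht).1 ((mem_splitTorusSub_iff t).mp ht).2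

/-- PROVED — **THE NON-SPLIT-TORUS LINE** of any Cartan torus lattice at a prime `q ∉ {2, 3}` (`Σ_{C(η)} χ_W = |C(η)|`, `CartanSupply.sum_char_centralizerSub`).
[folklore] -/
theorem exists_nonsplitLine_gen_of_ne_two (hq2 : q ≠ 2) (hq3 : q ≠ 3) (𝓛 : CartanTorusLattice q) :
    ∃ w : Fin 𝓛.d → ℤ, 𝓛.IsNonsplitFixed w ∧ w ≠ 0 ∧ ∀ v : Fin 𝓛.d → ℤ, 𝓛.IsNonsplitFixed v → ∃ m : ℤ, v = m • w := by
  have hsum : ∑ t : centralizerSub 𝓛.η, LinearMap.trace ℤ (Fin 𝓛.d → ℤ) (𝓛.ρ (t : G q)) = Nat.card (centralizerSub 𝓛.η) := by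
    simp_rw [𝓛.trace_eq]
    exact sum_char_centralizerSub hq2 hq3 𝓛.η_irred
  obtain ⟨w, hw, hw0, hgen⟩ :=
    exists_generator_of_trace_rep (𝓛.ρ : G q →* Module.End ℤ (Fin 𝓛.d → ℤ)) (centralizerSub 𝓛.η) hsum
  exact ⟨w, fun g hg => hw g ((mem_centralizerSub_iff 𝓛.η g).mpr hg), hw0,
    fun v hv => hgen v fun t ht => hv t ((mem_centralizerSub_iff 𝓛.η t).mp ht)⟩

end lines

/-- PROVED — the non-split-torus line at `q = 2`: the lattice has rank one (`χ_W(1) = 1`) and the centraliser `A₃` of `η` acts trivially (`χ_W = sgn`), so the constant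
vector `1` generates. [folklore] -/
theorem exists_nonsplitLine_gen_two (𝓛 : CartanTorusLattice 2) :
    ∃ w : Fin 𝓛.d → ℤ, 𝓛.IsNonsplitFixed w ∧ w ≠ 0 ∧ ∀ v : Fin 𝓛.d → ℤ, 𝓛.IsNonsplitFixed v → ∃ m : ℤ, v = m • w := by
  -- rank one
  have hd : 𝓛.d = 1 := by
    have h := 𝓛.trace_eq 1
    rw [map_one, LinearMap.trace_one, Module.finrank_fin_fun, cubicNewvectorChar_two_one] at h
    exact_mod_cast h
  -- every vector is fixed by the non-split torus
  have hns_all : ∀ v, 𝓛.IsNonsplitFixed v := by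
    intro v g hg
    rcases gl2_two_centraliser 𝓛.η 𝓛.η_irred g hg with h1 | hχ
    · rw [h1, map_one]; rfl
    · have htr := 𝓛.trace_eq g
      rw [hχ] at htr
      rw [endo_apply_eq_trace_smul hd (𝓛.ρ g) v, htr, one_smul]
  have h0 : 0 < 𝓛.d := by omega
  refine ⟨fun _ => 1, hns_all _, ?_, fun v _ => ⟨v ⟨0, h0⟩, ?_⟩⟩
  · intro h
    have h' := congrFun h ⟨0, h0⟩
    simp at h'
  · funext i
    have hi : i = ⟨0, h0⟩ := Fin.ext (by have := i.2; omega)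
    subst hi
    simp

section assembly

variable {q : ℕ} [Fact q.Prime]

/-- PROVED — the non-split-torus line of any Cartan torus lattice at any prime `q ≠ 3`. [folklore] -/
theorem exists_nonsplitLine_gen (hq3 : q ≠ 3) (𝓛 : CartanTorusLattice q) :
    ∃ w : Fin 𝓛.d → ℤ, 𝓛.IsNonsplitFixed w ∧ w ≠ 0 ∧ ∀ v : Fin 𝓛.d → ℤ, 𝓛.IsNonsplitFixed v → ∃ m : ℤ, v = m • w := by
  by_cases hq2 : q = 2
  · subst hq2
    exact exists_nonsplitLine_gen_two 𝓛
  · exact exists_nonsplitLine_gen_of_ne_two hq2 hq3 𝓛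

/-- PROVED: on a line, «not divisible by `3` in the lattice» gives an index prime to `3`. [folklore] -/
theorem not_three_dvd_of_not_smul {d : ℕ} {u w : Fin d → ℤ} {i : ℤ} (hu : u = i • w) (h3 : ¬ ∃ v : Fin d → ℤ, u = (3 : ℤ) • v) :
    ¬ (3 : ℤ) ∣ i := by
  rintro ⟨k, hk⟩
  exact h3 ⟨k • w, by rw [hu, hk, mul_smul]⟩

/-- PROVED — **A TORUS–DEGREE DATUM FROM A LATTICE, TWO VECTORS AND THE SHEET COUNTS** (`q ≠ 3`): given a Cartan torus lattice `𝓛`, vectors `u_S ∈ 𝓛^{T_s}`,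
`u_C ∈ 𝓛^{C(η)}` not divisible by `3` in `𝓛`, `c > 0` and positive `degX0`, `degC` with the two sheet counts, there is a `CartanTorusDegreeData q` over `𝓛` with these
degrees (generators and indices supplied by §1). [folklore] -/
theorem exists_degreeData_of_lattice (hq3 : q ≠ 3) (𝓛 : CartanTorusLattice q) (c : ℚ) (hc : 0 < c)
    (uS uC : Fin 𝓛.d → ℤ) (huS : 𝓛.IsSplitFixed uS) (huC : 𝓛.IsNonsplitFixed uC)
    (h3S : ¬ ∃ v : Fin 𝓛.d → ℤ, uS = (3 : ℤ) • v) (h3C : ¬ ∃ v : Fin 𝓛.d → ℤ, uC = (3 : ℤ) • v)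
    (degX0 degC : ℕ) (hX0 : 0 < degX0) (hC0 : 0 < degC)
    (sheet_s : c * ((𝓛.B uS uS : ℤ) : ℚ) = ((q : ℚ) - 1) ^ 2 / 2 * (degX0 : ℚ))
    (sheet_C : c * ((𝓛.B uC uC : ℤ) : ℚ) = ((q : ℚ) ^ 2 - 1) / 2 * (degC : ℚ)) :
    ∃ 𝒟 : CartanTorusDegreeData q, 𝒟.toCartanTorusLattice = 𝓛 ∧ 𝒟.degX0 = degX0 ∧ 𝒟.degC = degC := by
  obtain ⟨wS, hwS, -, hgenS⟩ := exists_splitLine_gen 𝓛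
  obtain ⟨wC, hwC, -, hgenC⟩ := exists_nonsplitLine_gen hq3 𝓛
  obtain ⟨iS, hiS⟩ := hgenS uS huS
  obtain ⟨iC, hiC⟩ := hgenC uC huC
  exact ⟨{ toCartanTorusLattice := 𝓛, wS := wS, wC := wC, wS_fixed := hwS, wC_fixed := hwC, wS_gen := hgenS, wC_gen := hgenC,
           c := c, c_pos := hc, uS := uS, uC := uC, idxS := iS, idxC := iC, uS_eq := hiS, uC_eq := hiC,
           descent_s := not_three_dvd_of_not_smul hiS h3S, descent_C := not_three_dvd_of_not_smul hiC h3C,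
           degX0 := degX0, degC := degC, degX0_pos := hX0, degC_pos := hC0, sheet_s := sheet_s, sheet_C := sheet_C },
    rfl, rfl, rfl⟩

/-- PROVED — **A SATURATED PRE-DATUM FROM THE SAME THIN DATA** (`q ≠ 3`): as above, forgetting the mod-3 clause and ADDING (SAT₃) at `q ≡ 1 (mod 3)` for free
(`CartanSatOfNoFixed.satThree_ofDegreeData`). This is the constructor contract of (F2b♮). [folklore] -/
theorem exists_saturatedPre_of_lattice (hq3 : q ≠ 3) (𝓛 : CartanTorusLattice q) (c : ℚ) (hc : 0 < c)
    (uS uC : Fin 𝓛.d → ℤ) (huS : 𝓛.IsSplitFixed uS) (huC : 𝓛.IsNonsplitFixed uC)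
    (h3S : ¬ ∃ v : Fin 𝓛.d → ℤ, uS = (3 : ℤ) • v) (h3C : ¬ ∃ v : Fin 𝓛.d → ℤ, uC = (3 : ℤ) • v)
    (degX0 degC : ℕ) (hX0 : 0 < degX0) (hC0 : 0 < degC)
    (sheet_s : c * ((𝓛.B uS uS : ℤ) : ℚ) = ((q : ℚ) - 1) ^ 2 / 2 * (degX0 : ℚ))
    (sheet_C : c * ((𝓛.B uC uC : ℤ) : ℚ) = ((q : ℚ) ^ 2 - 1) / 2 * (degC : ℚ)) :
    ∃ 𝒟 : CartanTorusDegreeDataPre q, (q % 3 = 1 → 𝒟.SatThree) ∧ 𝒟.degX0 = degX0 ∧ 𝒟.degC = degC := by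
  obtain ⟨𝒟, -, h1, h2⟩ := exists_degreeData_of_lattice hq3 𝓛 c hc uS uC huS huC h3S h3C degX0 degC hX0 hC0 sheet_s sheet_C
  exact ⟨CartanTorusDegreeDataPre.ofDegreeData 𝒟, fun h => satThree_ofDegreeData h 𝒟, h1, h2⟩

end assembly

/-! ## §2 The THIN form of the dictionary implies (F2b♮) -/

/-- PROVED — **THE THIN DICTIONARY ⇒ (F2b♮)**: if at every Cartan place (binders VERBATIM those of (F2b♮)) there are a Cartan torus lattice `𝓛`, a normalisation
`c > 0`, torus-fixed vectors `u_S`, `u_C` not divisible by `3` in `𝓛`, and positive `degX0`, `degC` with the two sheet counts and `ord₃ degX0 = ord₃ Q'.deg`,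
`ord₃ degC = ord₃ Q.deg`, then the saturated dictionary (F2b♮) holds (hence NUM, by `CartanSaturatedDictionary.onePlaceLaw_of_saturatedDictionary`). The hypothesis is
written INLINE (no new named node): it is the exact list a geometric constructor of the v14 stub must deliver. [folklore] -/
theorem saturatedDictionary_of_latticeDictionary
    (h : ∀ (V : WeierstrassCurve ℚ) [V.IsElliptic] [V.IsGloballyMinimal], ClassX11b V 3 → Surj V 3 →
      ∀ (N D M : ℕ) (C : Finset ℕ) (q : ℕ) [Fact q.Prime]
        (X : CartanLevelCurveData D M C) (W₁ : WeierstrassCurve ℚ) [W₁.IsElliptic] (Q : CartanParametrizationData X W₁)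
        (X' : CartanLevelCurveData D (M * q ^ 2) (C.erase q)) (W₂ : WeierstrassCurve ℚ) [W₂.IsElliptic]
        (Q' : CartanParametrizationData X' W₂),
        V.conductorNorm ℤ = N → D * M * ∏ p ∈ C, p ^ 2 = N → q ∈ C → q ≠ 3 → ¬ q ^ 3 ∣ N →
        3 ∣ (V.baseChange ℚ_[q]).localTamagawaNumber ℤ_[q] →
        Q.IsMinimalFor V → Q'.IsMinimalFor V →
        ∃ (𝓛 : CartanTorusLattice q) (c : ℚ) (uS uC : Fin 𝓛.d → ℤ) (degX0 degC : ℕ),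
          0 < c ∧ 𝓛.IsSplitFixed uS ∧ 𝓛.IsNonsplitFixed uC ∧
          (¬ ∃ v : Fin 𝓛.d → ℤ, uS = (3 : ℤ) • v) ∧ (¬ ∃ v : Fin 𝓛.d → ℤ, uC = (3 : ℤ) • v) ∧ 0 < degX0 ∧ 0 < degC ∧
          c * ((𝓛.B uS uS : ℤ) : ℚ) = ((q : ℚ) - 1) ^ 2 / 2 * (degX0 : ℚ) ∧
          c * ((𝓛.B uC uC : ℤ) : ℚ) = ((q : ℚ) ^ 2 - 1) / 2 * (degC : ℚ) ∧
          padicValNat 3 degX0 = padicValNat 3 Q'.deg ∧ padicValNat 3 degC = padicValNat 3 Q.deg) :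
    CartanHomLatticeSaturatedDictionaryAtThree := by
  intro V _ _ hX hS N D M C q _ X W₁ _ Q X' W₂ _ Q' hN hDMC hq hq3 hq3N hc hQ hQ'
  obtain ⟨𝓛, c, uS, uC, degX0, degC, hc0, huS, huC, h3S, h3C, hX0, hC0, hs, hC, hv1, hv2⟩ :=
    h V hX hS N D M C q X W₁ Q X' W₂ Q' hN hDMC hq hq3 hq3N hc hQ hQ'
  obtain ⟨𝒟, hsat, h1, h2⟩ := exists_saturatedPre_of_lattice hq3 𝓛 c hc0 uS uC huS huC h3S h3C degX0 degC hX0 hC0 hs hC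
  exact ⟨𝒟, hsat, by rw [h1]; exact hv1, by rw [h2]; exact hv2⟩

end Summit.BirchSwinnertonDyer.BirchSwinnertonDyer.Theorems.CartanPreDatumOfLattice
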